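import Summits.ABC.StewartYu.PadicG3Levels
import HarnessLib

/-!
# Cell abc-stewartyu, WP-L.P(odd) (RouteGA crux `PadicCoreOddRat`): the k-STEP of the odd-`p` Gen-3 frame with an ABSTRACT
# MONOMIAL-CLEARING DATUM, and the level invariant of the SATURATED frame

`Summits/ABC/StewartYu/PadicG3SatKStep.lean` — cell `abc-stewartyu` (HOME `run/shared/lean/pub/abc-stewartyu/`, design memo
HOME/p2/memo-07-WPLP-odd-Nframe-design.md §2 rows «k-step Liouville» / «level invariant»; seat p2-g5).  Theorems and one `Prop`-valued
structure on `G3Setup`; no named fact, no parameters.  Kill test K2 of the memo: the analytic core of the landed frame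
(`PadicG3KStepPhi.norm_g3F_le_of_zerosΦ`, `PadicG3KStepPhiOdd.norm_g3F_le_of_zerosΦ_oddNodes`) is consumed UNMODIFIED.

The landed k-step (`PadicG3KStepPhi.g3_kstep_pm`, `PadicG3ValuesGen.g3φ_eq_zero_of_norm_lt`) clears the monomials `∏ⱼ αⱼ^{vᵢⱼx}` of the
class family with the box denominator `monDen α (Dbox·|x|)` of the COORDINATE box `|vᵢⱼ| ≤ Dboxⱼ`.  In the saturated frame (generators
`S.α := θ`, a Kummer basis of the saturation of the original group `⟨α⟩`, memo §1) the family is a SKEW box in θ-coordinates and is cleared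
through its VIRTUAL α-coordinates instead (`SatCoords.exists_int_monDen_mul_prod_zpow_sat`: same denominator `monDen α E`, same numerator
bound).  This file therefore re-states the Liouville step and the k-step with the monomial clearing as an ABSTRACT per-point datum

  `Dm x ∈ ℕ`, `1 ≤ Dm x`, `Mm x ∈ ℤ`:  `Dm x · ∏ⱼ αⱼ^{vᵢⱼ x} = z ∈ ℤ`, `|z| ≤ Mm x`  for every `i ∈ B`

(the landed instance is `Dm = monDen α (Dbox·|x|)`, `Mm = Dm²`; the saturated instance is supplied from the virtual box by `SatCoords`):

* `exists_int_clear_mul_coef_gen`, `exists_int_clear_mul_g3φ_gen`, **`g3φ_eq_zero_of_norm_lt_gen`** (`K ≥ #B·P·M₀·Xb^{|t|}·Mm`);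
* **`g3_kstep_pm_gen`**, **`g3_kstep_pm_oddNodes_gen`** — the two k-steps on two sign classes, proofs = the landed ones with the last line
  swapped (the extrapolation halves are the landed `norm_g3F_le_of_zerosΦ(_oddNodes)` verbatim);
* `LvInvSat U R B v sgn pv Bv P m Xs T` — the level invariant of the saturated frame: the landed `LvInv` with the coordinate box replaced by
  the VIRTUAL box `|(vᵢ ᵥ* U)ⱼ| ≤ Bvⱼ` (`U` the integer matrix with `θᵢ^N = ∏ αⱼ^{Uᵢⱼ}`), and `LvInvSat.kstep` / `LvInvSat.kstep_odd` /
  `LvInvSat.mono`.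

WHAT THIS IS NOT: no instance of the datum (that is `SatCoords` + the record), no half-step, no START; no crux moves.

References: Yu. V. Nesterenko, LNM 1819 (2003) §3.2, Lemma 3.11, Prop. 4.1; K. Yu, Acta Math. 211 (2013), (5.35)–(5.41), Lemma 5.2.
-/

noncomputable section

open Finset Polynomial
open scoped Matrix
open Literature.NumberTheory.Transcendental
open Literature.NumberTheory.Transcendental.PadicCW77 (condExp)
open Literature.NumberTheory.Transcendental.CW77.Setup (Tau tauNorm)
open scoped Nat

namespace Summit.ABC.StewartYu

namespace G3Setup

variable {p : ℕ} [Fact p.Prime] (S : G3Setup p) {ι : Type*} (R : ι → ℚ[X]) (v : ι → Fin S.n → ℤ)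

/-! ### The value cleared with an abstract monomial datum, and the Liouville inequality -/

/-- **One coefficient cleared** (abstract monomial datum): if `Dm·∏αⱼ^{vᵢⱼx} = z₂ ∈ ℤ` with `|z₂| ≤ Mm`, then
`D·[(Hasse_{t₀} Rᵢ)(x)·zγpow·∏αⱼ^{vᵢⱼx}] ∈ ℤ`, `|·| ≤ M₀·Xb^{|t|}·Mm`, `D = den₀·|b_{j₀}|^{|t|}·Dm`. [cite: Yu2013, (5.35); shape only] -/
theorem exists_int_clear_mul_coef_gen (i : ι) (τ : Tau S.n) (x : ℤ) {den₀ : ℕ} {M₀ : ℤ}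
    (hR : ∃ z₀ : ℤ, (den₀ : ℚ) * (hasseDeriv τ.1 (R i)).eval (x : ℚ) = z₀ ∧ |z₀| ≤ M₀)
    {Xb : ℤ} (hX : ∀ k, |S.𝔛 (v i) k| ≤ Xb) {Dm : ℕ} {Mm : ℤ}
    (hm : ∃ z₂ : ℤ, ((Dm : ℕ) : ℚ) * ∏ j, S.α j ^ (v i j * x) = z₂ ∧ |z₂| ≤ Mm) :
    ∃ z : ℤ, ((den₀ * (S.b S.j₀).natAbs ^ (∑ k, τ.2 k) * Dm : ℕ) : ℚ) *
        ((hasseDeriv τ.1 (R i)).eval (x : ℚ) * S.zγpow v i τ.2 * ∏ j, S.α j ^ (v i j * x)) = z ∧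
      |z| ≤ M₀ * Xb ^ (∑ k, τ.2 k) * Mm := by
  obtain ⟨z₀, hz₀, hz₀le⟩ := hR
  obtain ⟨z₂, hz₂, hz₂le⟩ := hm
  set z₁ : ℤ := ∏ k, S.𝔛 (v i) k ^ τ.2 k with hz₁
  have hz₁q : (((S.b S.j₀).natAbs ^ (∑ k, τ.2 k) : ℕ) : ℚ) * S.zγpow v i τ.2 = ((S.b S.j₀).sign : ℚ) ^ (∑ k, τ.2 k) * z₁ := by
    have hsgn : (((S.b S.j₀).natAbs : ℕ) : ℚ) = ((S.b S.j₀).sign : ℚ) * S.b S.j₀ := by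
      rw [Nat.cast_natAbs]; push_cast
      rw [← Int.cast_abs, ← Int.sign_mul_self_eq_abs]; push_cast; ring
    push_cast
    rw [hsgn, mul_pow, mul_assoc, S.bj₀_pow_mul_zγpow, hz₁]
    push_cast; ring
  have hz₁le : |z₁| ≤ Xb ^ (∑ k, τ.2 k) := S.abs_prod_𝔛_pow_le v i τ.2 hX
  have hsgn1 : |((S.b S.j₀).sign : ℤ) ^ (∑ k, τ.2 k)| = 1 := by
    rw [abs_pow]
    have : |(S.b S.j₀).sign| = 1 := by
      rcases lt_or_gt_of_ne S.bj₀_ne with h | h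
      · rw [Int.sign_eq_neg_one_of_neg h]; rfl
      · rw [Int.sign_eq_one_of_pos h]; rfl
    rw [this, one_pow]
  refine ⟨z₀ * ((S.b S.j₀).sign ^ (∑ k, τ.2 k) * z₁) * z₂, ?_, ?_⟩
  · push_cast
    have e1 := hz₀
    have e2 := hz₁q
    have e3 := hz₂
    push_cast at e2 e3
    calc ((den₀ : ℚ) * (((S.b S.j₀).natAbs : ℕ) : ℚ) ^ (∑ k, τ.2 k) * (Dm : ℚ)) *
          ((hasseDeriv τ.1 (R i)).eval (x : ℚ) * S.zγpow v i τ.2 * ∏ j, S.α j ^ (v i j * x))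
        = ((den₀ : ℚ) * (hasseDeriv τ.1 (R i)).eval (x : ℚ)) *
          (((((S.b S.j₀).natAbs : ℕ) : ℚ) ^ (∑ k, τ.2 k)) * S.zγpow v i τ.2) *
          ((Dm : ℚ) * ∏ j, S.α j ^ (v i j * x)) := by ring
      _ = (z₀ : ℚ) * (((S.b S.j₀).sign : ℚ) ^ (∑ k, τ.2 k) * z₁) * z₂ := by rw [e1, e2, e3]
  · have h0 : (0 : ℤ) ≤ M₀ := (abs_nonneg _).trans hz₀le
    rw [abs_mul, abs_mul, abs_mul, hsgn1, one_mul]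
    have hXb : (0 : ℤ) ≤ Xb ^ (∑ k, τ.2 k) := (abs_nonneg _).trans hz₁le
    calc |z₀| * |z₁| * |z₂| ≤ M₀ * Xb ^ (∑ k, τ.2 k) * |z₂| := by
          refine mul_le_mul_of_nonneg_right ?_ (abs_nonneg _)
          exact mul_le_mul hz₀le hz₁le (abs_nonneg _) h0
      _ ≤ M₀ * Xb ^ (∑ k, τ.2 k) * Mm := mul_le_mul_of_nonneg_left hz₂le (mul_nonneg h0 hXb)

/-- **The value cleared** (abstract monomial datum): `D·g3φ τ x ∈ ℤ` with `|·| ≤ #B·P·M₀·Xb^{|t|}·Mm`, `D = den₀·|b_{j₀}|^{|t|}·Dm`.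
[cite: Yu2013, (5.35)–(5.39); shape only] -/
theorem exists_int_clear_mul_g3φ_gen (B : Finset ι) (pv : ι → ℤ) (τ : Tau S.n) (x : ℤ) {den₀ : ℕ} {M₀ : ℤ}
    (hR : ∀ i ∈ B, ∃ z₀ : ℤ, (den₀ : ℚ) * (hasseDeriv τ.1 (R i)).eval (x : ℚ) = z₀ ∧ |z₀| ≤ M₀)
    {Xb : ℤ} (hX : ∀ i ∈ B, ∀ k, |S.𝔛 (v i) k| ≤ Xb) {P : ℤ} (hP : ∀ i ∈ B, |pv i| ≤ P) {Dm : ℕ} {Mm : ℤ}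
    (hm : ∀ i ∈ B, ∃ z₂ : ℤ, ((Dm : ℕ) : ℚ) * ∏ j, S.α j ^ (v i j * x) = z₂ ∧ |z₂| ≤ Mm) :
    ∃ z : ℤ, ((den₀ * (S.b S.j₀).natAbs ^ (∑ k, τ.2 k) * Dm : ℕ) : ℚ) * S.g3φ R v B pv τ x = z ∧
      |z| ≤ B.card * P * (M₀ * Xb ^ (∑ k, τ.2 k) * Mm) := by
  classical
  have hcoef : ∀ i ∈ B, ∃ z : ℤ, ((den₀ * (S.b S.j₀).natAbs ^ (∑ k, τ.2 k) * Dm : ℕ) : ℚ) *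
        ((hasseDeriv τ.1 (R i)).eval (x : ℚ) * S.zγpow v i τ.2 * ∏ j, S.α j ^ (v i j * x)) = z ∧
      |z| ≤ M₀ * Xb ^ (∑ k, τ.2 k) * Mm :=
    fun i hi => S.exists_int_clear_mul_coef_gen R v i τ x (hR i hi) (hX i hi) (hm i hi)
  choose! z hz hzle using hcoef
  refine ⟨∑ i ∈ B, pv i * z i, ?_, ?_⟩
  · unfold g3φ
    rw [Finset.mul_sum]
    push_cast
    refine Finset.sum_congr rfl fun i hi => ?_
    have h := hz i hi
    push_cast at h
    calc ((den₀ : ℚ) * (((S.b S.j₀).natAbs : ℕ) : ℚ) ^ (∑ k, τ.2 k) * (Dm : ℚ)) *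
          ((pv i : ℚ) * (hasseDeriv τ.1 (R i)).eval (x : ℚ) * S.zγpow v i τ.2 * ∏ j, S.α j ^ (v i j * x))
        = (pv i : ℚ) * (((den₀ : ℚ) * (((S.b S.j₀).natAbs : ℕ) : ℚ) ^ (∑ k, τ.2 k) * (Dm : ℚ)) *
          ((hasseDeriv τ.1 (R i)).eval (x : ℚ) * S.zγpow v i τ.2 * ∏ j, S.α j ^ (v i j * x))) := by ring
      _ = (pv i : ℚ) * (z i : ℚ) := by rw [h]
  · calc |∑ i ∈ B, pv i * z i| ≤ ∑ i ∈ B, |pv i * z i| := Finset.abs_sum_le_sum_abs _ _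
      _ ≤ ∑ i ∈ B, P * (M₀ * Xb ^ (∑ k, τ.2 k) * Mm) := by
          refine Finset.sum_le_sum fun i hi => ?_
          rw [abs_mul]
          have hP0 : (0 : ℤ) ≤ P := (abs_nonneg _).trans (hP i hi)
          exact mul_le_mul (hP i hi) (hzle i hi) (abs_nonneg _) hP0
      _ = B.card * P * (M₀ * Xb ^ (∑ k, τ.2 k) * Mm) := by
          rw [Finset.sum_const, nsmul_eq_mul]; ring

/-- **THE LIOUVILLE INEQUALITY AT THE INTEGER POINTS, abstract monomial datum** (small ⇒ zero): if `‖g3φ τ x‖_p < 1/K` with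
`K ≥ #B·P·M₀·Xb^{|t|}·Mm`, then `g3φ τ x = 0`. [cite: Yu2013, (5.40)–(5.41); shape only] -/
theorem g3φ_eq_zero_of_norm_lt_gen (B : Finset ι) (pv : ι → ℤ) (τ : Tau S.n) (x : ℤ) {den₀ : ℕ} (hden₀ : 1 ≤ den₀) {M₀ : ℤ}
    (hR : ∀ i ∈ B, ∃ z₀ : ℤ, (den₀ : ℚ) * (hasseDeriv τ.1 (R i)).eval (x : ℚ) = z₀ ∧ |z₀| ≤ M₀)
    {Xb : ℤ} (hX : ∀ i ∈ B, ∀ k, |S.𝔛 (v i) k| ≤ Xb) {P : ℤ} (hP : ∀ i ∈ B, |pv i| ≤ P)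
    {Dm : ℕ} (hDm : 1 ≤ Dm) {Mm : ℤ}
    (hm : ∀ i ∈ B, ∃ z₂ : ℤ, ((Dm : ℕ) : ℚ) * ∏ j, S.α j ^ (v i j * x) = z₂ ∧ |z₂| ≤ Mm)
    {K : ℝ} (hK : (B.card : ℝ) * P * (M₀ * (Xb : ℝ) ^ (∑ k, τ.2 k) * (Mm : ℝ)) ≤ K)
    (hK0 : 0 < K) (hlt : ‖((S.g3φ R v B pv τ x : ℚ) : ℚ_[p])‖ < 1 / K) :
    S.g3φ R v B pv τ x = 0 := by
  classical
  by_contra hne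
  have hb1 : 1 ≤ (S.b S.j₀).natAbs := Int.natAbs_pos.mpr S.bj₀_ne
  set D : ℕ := den₀ * (S.b S.j₀).natAbs ^ (∑ k, τ.2 k) * Dm with hDdef
  have hD1 : 1 ≤ D := one_le_mul (one_le_mul hden₀ (Nat.one_le_pow _ _ hb1)) hDm
  obtain ⟨z, hz, hzle⟩ := S.exists_int_clear_mul_g3φ_gen R v B pv τ x hR hX hP hm
  have hDpos : (0 : ℝ) < (D : ℝ) := by exact_mod_cast (show 0 < D by omega)
  have hφ : |((S.g3φ R v B pv τ x : ℚ) : ℝ)| ≤ K / (D : ℝ) := by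
    rw [le_div_iff₀ hDpos]
    have h2 : (D : ℝ) * ((S.g3φ R v B pv τ x : ℚ) : ℝ) = (z : ℝ) := by
      have := congrArg (fun q : ℚ => (q : ℝ)) hz
      rw [hDdef]
      push_cast at this ⊢
      exact this
    have h1 : |((S.g3φ R v B pv τ x : ℚ) : ℝ)| * (D : ℝ) = |(z : ℝ)| := by
      rw [← h2, abs_mul, Nat.abs_cast, mul_comm]
    rw [h1]
    have hzR : |(z : ℝ)| ≤ (B.card : ℝ) * P * (M₀ * (Xb : ℝ) ^ (∑ k, τ.2 k) * (Mm : ℝ)) := by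
      have := (Int.cast_le (R := ℝ)).mpr hzle
      push_cast at this
      linarith
    exact hzR.trans hK
  have hge := SetupQ.padicNorm_ge_of_int_mul (p := p) hne hD1 ⟨z, hz⟩ hφ
  have hKD : (D : ℝ) * (K / (D : ℝ)) = K := by field_simp
  rw [hKD] at hge
  exact absurd hge (not_le.mpr hlt)

/-! ### The two k-steps on two sign classes, abstract monomial datum -/

/-- **The k-step on two sign classes, abstract monomial datum** (symmetric nodes `|x| ≤ N` → `|x₁| ≤ N′`, orders `|τ| + t ≤ Tlo`):
the landed extrapolation `norm_g3F_le_of_zerosΦ` + `g3φ_eq_zero_of_norm_lt_gen`. [cite: Yu2013, Lemma 5.2] [cite: Nesterenko2003, §4.2] -/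
theorem g3_kstep_pm_gen (m : ℕ) (B : Finset ι) (hB : ∀ i ∈ B, ‖S.E (v i)‖ ≤ (p : ℝ)⁻¹ ^ (m + 1))
    (sgn : ι → ℤ) (hsgn : ∀ i, sgn i = 1 ∨ sgn i = -1) (hcls : ∀ i ∈ B, S.cls (v i) = (sgn i : ℚ_[p]))
    (pv : ι → ℤ) {N N' Tlo t : ℕ} (ht : 1 ≤ t)
    {Bw : ℝ} (hBw0 : 0 ≤ Bw) (hBw : ∀ i ∈ B, ∀ t₀ k, ‖(hw (p := p) R i t₀).coeff k‖ * ((p : ℝ) ^ m * Real.sqrt p) ^ k ≤ Bw)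
    (hΛ : ‖S.Λ / (S.b S.j₀ : ℚ_[p])‖ ≤ (p : ℝ)⁻¹)
    (hzero : ∀ x : ℤ, |x| ≤ (N : ℤ) → ∀ τ'' : Tau S.n, tauNorm τ'' < Tlo → S.g3φ R v B (pvx sgn pv x) τ'' x = 0)
    (den₀ : ℤ → Tau S.n → ℕ) (hden₀ : ∀ x τ, 1 ≤ den₀ x τ) (M₀ : ℤ → Tau S.n → ℤ)
    (hR : ∀ (x : ℤ) (τ : Tau S.n), ∀ i ∈ B, ∃ z₀ : ℤ, (den₀ x τ : ℚ) * (hasseDeriv τ.1 (R i)).eval (x : ℚ) = z₀ ∧ |z₀| ≤ M₀ x τ)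
    {Xb : ℤ} (hX : ∀ i ∈ B, ∀ k, |S.𝔛 (v i) k| ≤ Xb) {P : ℤ} (hP : ∀ i ∈ B, |pv i| ≤ P)
    (Dm : ℤ → ℕ) (hDm : ∀ x, 1 ≤ Dm x) (Mm : ℤ → ℤ)
    (hm : ∀ x : ℤ, ∀ i ∈ B, ∃ z₂ : ℤ, ((Dm x : ℕ) : ℚ) * ∏ j, S.α j ^ (v i j * x) = z₂ ∧ |z₂| ≤ Mm x)
    (K : ℤ → Tau S.n → ℝ) (hK0 : ∀ x τ, 0 < K x τ)
    (hK : ∀ (x : ℤ) (τ : Tau S.n), (B.card : ℝ) * P * (M₀ x τ * (Xb : ℝ) ^ (∑ k, τ.2 k) * (Mm x : ℝ)) ≤ K x τ)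
    (hfinal : ∀ x₁ : ℤ, |x₁| ≤ (N' : ℤ) → ∀ τ : Tau S.n, tauNorm τ + t ≤ Tlo →
      max (Bw * ‖S.Λ / (S.b S.j₀ : ℚ_[p])‖ * (p : ℝ) ^ ((t - 1) / 2) * (p : ℝ) ^ condExp p (2 * N + 1) t)
        (Bw / ((p : ℝ) ^ m * Real.sqrt p) ^ ((2 * N + 1) * t)) < 1 / K x₁ τ) :
    ∀ x₁ : ℤ, |x₁| ≤ (N' : ℤ) → ∀ τ : Tau S.n, tauNorm τ + t ≤ Tlo → S.g3φ R v B (pvx sgn pv x₁) τ x₁ = 0 := by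
  intro x₁ hx₁ τ hτ
  have hz : ‖((x₁ : ℤ) : ℚ_[p])‖ ≤ 1 := Padic.norm_int_le_one (p := p) x₁
  have hzeroΦ : ∀ x : ℤ, |x| ≤ (N : ℤ) → ∀ τ'' : Tau S.n, tauNorm τ'' < Tlo → S.g3Φ R v B pv τ'' (x : ℚ_[p]) = 0 := by
    intro x hx τ'' hτ''
    rw [S.g3Φ_intCast_pm R v B sgn hsgn hcls, hzero x hx τ'' hτ'', Rat.cast_zero]
  have hcore := (S.norm_g3F_le_of_zerosΦ R v m B hB pv ht hBw0 hBw hΛ hzeroΦ hz τ hτ).2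
  rw [S.g3Φ_intCast_pm R v B sgn hsgn hcls] at hcore
  exact S.g3φ_eq_zero_of_norm_lt_gen R v B (pvx sgn pv x₁) τ x₁ (hden₀ x₁ τ) (hR x₁ τ) hX
    (fun i hi => abs_pvx_le hsgn (hP i hi) x₁) (hDm x₁) (hm x₁) (hK x₁ τ) (hK0 x₁ τ)
    (lt_of_le_of_lt hcore (hfinal x₁ hx₁ τ hτ))

/-- **The odd-node k-step on two sign classes, abstract monomial datum** (odd `|x| ≤ 2N − 1` → all `|x₁| ≤ N′`).
[cite: Nesterenko2003, §4.2–4.3] -/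
theorem g3_kstep_pm_oddNodes_gen (m : ℕ) (B : Finset ι) (hB : ∀ i ∈ B, ‖S.E (v i)‖ ≤ (p : ℝ)⁻¹ ^ (m + 1))
    (sgn : ι → ℤ) (hsgn : ∀ i, sgn i = 1 ∨ sgn i = -1) (hcls : ∀ i ∈ B, S.cls (v i) = (sgn i : ℚ_[p]))
    (pv : ι → ℤ) {N N' Tlo t : ℕ} (ht : 1 ≤ t)
    {Bw : ℝ} (hBw0 : 0 ≤ Bw) (hBw : ∀ i ∈ B, ∀ t₀ k, ‖(hw (p := p) R i t₀).coeff k‖ * ((p : ℝ) ^ m * Real.sqrt p) ^ k ≤ Bw)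
    (hΛ : ‖S.Λ / (S.b S.j₀ : ℚ_[p])‖ ≤ (p : ℝ)⁻¹)
    (hzero : ∀ x : ℤ, Odd x → |x| ≤ (2 * N - 1 : ℤ) → ∀ τ'' : Tau S.n, tauNorm τ'' < Tlo → S.g3φ R v B (pvx sgn pv x) τ'' x = 0)
    (den₀ : ℤ → Tau S.n → ℕ) (hden₀ : ∀ x τ, 1 ≤ den₀ x τ) (M₀ : ℤ → Tau S.n → ℤ)
    (hR : ∀ (x : ℤ) (τ : Tau S.n), ∀ i ∈ B, ∃ z₀ : ℤ, (den₀ x τ : ℚ) * (hasseDeriv τ.1 (R i)).eval (x : ℚ) = z₀ ∧ |z₀| ≤ M₀ x τ)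
    {Xb : ℤ} (hX : ∀ i ∈ B, ∀ k, |S.𝔛 (v i) k| ≤ Xb) {P : ℤ} (hP : ∀ i ∈ B, |pv i| ≤ P)
    (Dm : ℤ → ℕ) (hDm : ∀ x, 1 ≤ Dm x) (Mm : ℤ → ℤ)
    (hm : ∀ x : ℤ, ∀ i ∈ B, ∃ z₂ : ℤ, ((Dm x : ℕ) : ℚ) * ∏ j, S.α j ^ (v i j * x) = z₂ ∧ |z₂| ≤ Mm x)
    (K : ℤ → Tau S.n → ℝ) (hK0 : ∀ x τ, 0 < K x τ)
    (hK : ∀ (x : ℤ) (τ : Tau S.n), (B.card : ℝ) * P * (M₀ x τ * (Xb : ℝ) ^ (∑ k, τ.2 k) * (Mm x : ℝ)) ≤ K x τ)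
    (hfinal : ∀ x₁ : ℤ, |x₁| ≤ (N' : ℤ) → ∀ τ : Tau S.n, tauNorm τ + t ≤ Tlo →
      max (Bw * ‖S.Λ / (S.b S.j₀ : ℚ_[p])‖ * (p : ℝ) ^ ((t - 1) / 2) * (p : ℝ) ^ condExp p (2 * N) t)
        (Bw / ((p : ℝ) ^ m * Real.sqrt p) ^ ((2 * N) * t)) < 1 / K x₁ τ) :
    ∀ x₁ : ℤ, |x₁| ≤ (N' : ℤ) → ∀ τ : Tau S.n, tauNorm τ + t ≤ Tlo → S.g3φ R v B (pvx sgn pv x₁) τ x₁ = 0 := by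
  intro x₁ hx₁ τ hτ
  have hz : ‖((x₁ : ℤ) : ℚ_[p])‖ ≤ 1 := Padic.norm_int_le_one (p := p) x₁
  have hzeroΦ : ∀ x : ℤ, Odd x → |x| ≤ (2 * N - 1 : ℤ) → ∀ τ'' : Tau S.n, tauNorm τ'' < Tlo →
      S.g3Φ R v B pv τ'' (x : ℚ_[p]) = 0 := by
    intro x hx hx' τ'' hτ''
    rw [S.g3Φ_intCast_pm R v B sgn hsgn hcls, hzero x hx hx' τ'' hτ'', Rat.cast_zero]
  have hcore := (S.norm_g3F_le_of_zerosΦ_oddNodes R v m B hB pv ht hBw0 hBw hΛ hzeroΦ hz τ hτ).2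
  rw [S.g3Φ_intCast_pm R v B sgn hsgn hcls] at hcore
  exact S.g3φ_eq_zero_of_norm_lt_gen R v B (pvx sgn pv x₁) τ x₁ (hden₀ x₁ τ) (hR x₁ τ) hX
    (fun i hi => abs_pvx_le hsgn (hP i hi) x₁) (hDm x₁) (hm x₁) (hK x₁ τ) (hK0 x₁ τ)
    (lt_of_le_of_lt hcore (hfinal x₁ hx₁ τ hτ))

/-! ### The level invariant of the saturated frame -/

/-- **The level invariant of the SATURATED odd-`p` frame**: the landed `LvInv` with the coordinate box replaced by the VIRTUAL box
`|(vᵢ ᵥ* U)ⱼ| ≤ Bvⱼ` (`U` the integer matrix `θᵢ^N = ∏ αⱼ^{Uᵢⱼ}` of `SatCoords`; `Bvⱼ = ⌊N·sideⱼ/2^{lev}⌋`).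
[cite: Nesterenko2003, Prop 4.1 with §3.5 (𝔏 ⊂ 𝔑); shape only] -/
structure LvInvSat (U : Matrix (Fin S.n) (Fin S.n) ℤ) (R : ι → ℚ[X]) (B : Finset ι) (v : ι → Fin S.n → ℤ) (sgn pv : ι → ℤ)
    (Bv : Fin S.n → ℕ) (P : ℤ) (m : ℕ) (Xs : Set ℤ) (T : ℕ) : Prop where
  /-- some coefficient is non-zero -/
  nonzero : ∃ i ∈ B, pv i ≠ 0
  /-- the coefficients are bounded -/
  bound : ∀ i ∈ B, |pv i| ≤ P
  /-- the exponents lie in the VIRTUAL box -/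
  vbox : ∀ i ∈ B, ∀ j, |(v i ᵥ* U) j| ≤ (Bv j : ℤ)
  /-- the signs are `±1` -/
  sgn_pm : ∀ i, sgn i = 1 ∨ sgn i = -1
  /-- two sign classes -/
  cls : ∀ i ∈ B, S.cls (v i) = (sgn i : ℚ_[p])
  /-- slab depth of the exponents -/
  depth : ∀ i ∈ B, ‖S.E (v i)‖ ≤ (p : ℝ)⁻¹ ^ (m + 1)
  /-- slab depth of the differences -/
  slab : ∀ i ∈ B, ∀ i' ∈ B, ‖S.Lsum (v i) - S.Lsum (v i')‖ ≤ (p : ℝ)⁻¹ ^ (m + 1)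
  /-- the vanishing at the nodes, with sign-twisted coefficients -/
  vanish : ∀ x ∈ Xs, ∀ τ : Tau S.n, tauNorm τ < T → S.g3φ R v B (pvx sgn pv x) τ x = 0

namespace LvInvSat

variable {S} {U : Matrix (Fin S.n) (Fin S.n) ℤ} {R : ι → ℚ[X]} {B : Finset ι} {v : ι → Fin S.n → ℤ} {sgn pv : ι → ℤ}
  {Bv : Fin S.n → ℕ} {P : ℤ} {m : ℕ} {Xs : Set ℤ} {T : ℕ}

/-- Changing the node set and the order by an implication. [folklore] -/
theorem mono (h : S.LvInvSat U R B v sgn pv Bv P m Xs T) {Xs' : Set ℤ} {T' : ℕ} (hX : Xs' ⊆ Xs) (hT : T' ≤ T) :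
    S.LvInvSat U R B v sgn pv Bv P m Xs' T' :=
  ⟨h.nonzero, h.bound, h.vbox, h.sgn_pm, h.cls, h.depth, h.slab, fun x hx τ hτ => h.vanish x (hX hx) τ (lt_of_lt_of_le hτ hT)⟩

/-- Forgetting the virtual box gives the landed invariant with any coordinate box that happens to hold (bridge for files stated on
`LvInv`). [folklore] -/
theorem toLvInv (h : S.LvInvSat U R B v sgn pv Bv P m Xs T) {L : Fin S.n → ℕ} (hL : ∀ i ∈ B, ∀ j, |v i j| ≤ (L j : ℤ)) :
    S.LvInv R B v sgn pv L P m Xs T :=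
  ⟨h.nonzero, h.bound, hL, h.sgn_pm, h.cls, h.depth, h.slab, h.vanish⟩

/-- **The k-step on the saturated invariant** (symmetric nodes `|x| ≤ N` → `|x| ≤ N′`, orders `T → T′` with `T′ + t ≤ T`), under the
record's `Y₀`-weight bound `Bw`, pointwise Liouville datum `(den₀, M₀, Xb, K)`, the MONOMIAL DATUM `(Dm, Mm)` of the virtual box, and the
numerical inequality `hfinal`. [cite: Nesterenko2003, §4.2] [cite: Yu2013, Lemma 5.2] -/
theorem kstep {N : ℕ} (h : S.LvInvSat U R B v sgn pv Bv P m {x : ℤ | |x| ≤ (N : ℤ)} T) {N' T' t : ℕ} (ht : 1 ≤ t) (hT : T' + t ≤ T)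
    {Bw : ℝ} (hBw0 : 0 ≤ Bw) (hBw : ∀ i ∈ B, ∀ t₀ k, ‖(hw (p := p) R i t₀).coeff k‖ * ((p : ℝ) ^ m * Real.sqrt p) ^ k ≤ Bw)
    (hΛ : ‖S.Λ / (S.b S.j₀ : ℚ_[p])‖ ≤ (p : ℝ)⁻¹)
    (den₀ : ℤ → Tau S.n → ℕ) (hden₀ : ∀ x τ, 1 ≤ den₀ x τ) (M₀ : ℤ → Tau S.n → ℤ)
    (hR : ∀ (x : ℤ) (τ : Tau S.n), ∀ i ∈ B, ∃ z₀ : ℤ, (den₀ x τ : ℚ) * (hasseDeriv τ.1 (R i)).eval (x : ℚ) = z₀ ∧ |z₀| ≤ M₀ x τ)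
    {Xb : ℤ} (hX : ∀ i ∈ B, ∀ k, |S.𝔛 (v i) k| ≤ Xb)
    (Dm : ℤ → ℕ) (hDm : ∀ x, 1 ≤ Dm x) (Mm : ℤ → ℤ)
    (hm : ∀ x : ℤ, ∀ i ∈ B, ∃ z₂ : ℤ, ((Dm x : ℕ) : ℚ) * ∏ j, S.α j ^ (v i j * x) = z₂ ∧ |z₂| ≤ Mm x)
    (K : ℤ → Tau S.n → ℝ) (hK0 : ∀ x τ, 0 < K x τ)
    (hK : ∀ (x : ℤ) (τ : Tau S.n), (B.card : ℝ) * P * (M₀ x τ * (Xb : ℝ) ^ (∑ k, τ.2 k) * (Mm x : ℝ)) ≤ K x τ)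
    (hfinal : ∀ x₁ : ℤ, |x₁| ≤ (N' : ℤ) → ∀ τ : Tau S.n, tauNorm τ + t ≤ T →
      max (Bw * ‖S.Λ / (S.b S.j₀ : ℚ_[p])‖ * (p : ℝ) ^ ((t - 1) / 2) * (p : ℝ) ^ condExp p (2 * N + 1) t)
        (Bw / ((p : ℝ) ^ m * Real.sqrt p) ^ ((2 * N + 1) * t)) < 1 / K x₁ τ) :
    S.LvInvSat U R B v sgn pv Bv P m {x : ℤ | |x| ≤ (N' : ℤ)} T' := by
  refine ⟨h.nonzero, h.bound, h.vbox, h.sgn_pm, h.cls, h.depth, h.slab, fun x₁ hx₁ τ hτ => ?_⟩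
  have hk := S.g3_kstep_pm_gen R v m B h.depth sgn h.sgn_pm h.cls pv ht hBw0 hBw hΛ
    (fun x hx τ'' hτ'' => h.vanish x hx τ'' hτ'') den₀ hden₀ M₀ hR hX h.bound Dm hDm Mm hm K hK0 hK hfinal
  exact hk x₁ hx₁ τ (by omega)

/-- **The first k-step of a level on the saturated invariant** (odd nodes `|x| ≤ 2N − 1` → all `|x| ≤ N′`).
[cite: Nesterenko2003, §4.2 with 𝒳_{s,0}] -/
theorem kstep_odd {N : ℕ} (h : S.LvInvSat U R B v sgn pv Bv P m {x : ℤ | Odd x ∧ |x| ≤ (2 * N - 1 : ℤ)} T) {N' T' t : ℕ}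
    (ht : 1 ≤ t) (hT : T' + t ≤ T)
    {Bw : ℝ} (hBw0 : 0 ≤ Bw) (hBw : ∀ i ∈ B, ∀ t₀ k, ‖(hw (p := p) R i t₀).coeff k‖ * ((p : ℝ) ^ m * Real.sqrt p) ^ k ≤ Bw)
    (hΛ : ‖S.Λ / (S.b S.j₀ : ℚ_[p])‖ ≤ (p : ℝ)⁻¹)
    (den₀ : ℤ → Tau S.n → ℕ) (hden₀ : ∀ x τ, 1 ≤ den₀ x τ) (M₀ : ℤ → Tau S.n → ℤ)
    (hR : ∀ (x : ℤ) (τ : Tau S.n), ∀ i ∈ B, ∃ z₀ : ℤ, (den₀ x τ : ℚ) * (hasseDeriv τ.1 (R i)).eval (x : ℚ) = z₀ ∧ |z₀| ≤ M₀ x τ)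
    {Xb : ℤ} (hX : ∀ i ∈ B, ∀ k, |S.𝔛 (v i) k| ≤ Xb)
    (Dm : ℤ → ℕ) (hDm : ∀ x, 1 ≤ Dm x) (Mm : ℤ → ℤ)
    (hm : ∀ x : ℤ, ∀ i ∈ B, ∃ z₂ : ℤ, ((Dm x : ℕ) : ℚ) * ∏ j, S.α j ^ (v i j * x) = z₂ ∧ |z₂| ≤ Mm x)
    (K : ℤ → Tau S.n → ℝ) (hK0 : ∀ x τ, 0 < K x τ)
    (hK : ∀ (x : ℤ) (τ : Tau S.n), (B.card : ℝ) * P * (M₀ x τ * (Xb : ℝ) ^ (∑ k, τ.2 k) * (Mm x : ℝ)) ≤ K x τ)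
    (hfinal : ∀ x₁ : ℤ, |x₁| ≤ (N' : ℤ) → ∀ τ : Tau S.n, tauNorm τ + t ≤ T →
      max (Bw * ‖S.Λ / (S.b S.j₀ : ℚ_[p])‖ * (p : ℝ) ^ ((t - 1) / 2) * (p : ℝ) ^ condExp p (2 * N) t)
        (Bw / ((p : ℝ) ^ m * Real.sqrt p) ^ ((2 * N) * t)) < 1 / K x₁ τ) :
    S.LvInvSat U R B v sgn pv Bv P m {x : ℤ | |x| ≤ (N' : ℤ)} T' := by
  refine ⟨h.nonzero, h.bound, h.vbox, h.sgn_pm, h.cls, h.depth, h.slab, fun x₁ hx₁ τ hτ => ?_⟩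
  have hk := S.g3_kstep_pm_oddNodes_gen R v m B h.depth sgn h.sgn_pm h.cls pv ht hBw0 hBw hΛ
    (fun x hx hx' τ'' hτ'' => h.vanish x ⟨hx, hx'⟩ τ'' hτ'') den₀ hden₀ M₀ hR hX h.bound Dm hDm Mm hm K hK0 hK hfinal
  exact hk x₁ hx₁ τ (by omega)

end LvInvSat

end G3Setup

end Summit.ABC.StewartYu

end
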